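import Mathlib

/-!
# AtomicSynthesis (stmt-QuantumFields-28126), stub `stub_singleSlot` — H1-algebra: moment-killing weights on the grid

AUTHOR: planner ym-idea-11 g14 (HOME `g14/momentWeights.lean`, sorry-free); landed verbatim by prover w4 g22 (`--supports 28126`;
also path α of 23138 / 22956).  H1 of `g14/stub-plan-singleSlot.md`: grid translates of a compactly supported bump `b` (`∫ b ≠ 0`)
combine to a bump with the same integral and vanishing moments of orders `1 … N−1` (`momentKilling`).  The moment matrix factors as
(partial-order-triangular, diagonal `∫ b`) × (multivariate Vandermonde on `{0,…,N−1}⁴`, invertible by Mathlib's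
`MvPolynomial.eq_zero_of_eval_zero_at_prod_finset`); then translation invariance of volume and the binomial expansion.
Elementary; no stub/crux/rung/summit is closed by this file; the YM mass gap is NOT proved. [folklore]
-/

set_option autoImplicit false

open scoped BigOperators
open Finset Matrix

namespace Summit.QuantumFields.YangMills.Cruxes.AtomicSynthesis.SingleSlotPlan

variable {d N : ℕ}

/-- Index box `{0,…,N−1}ᵈ` (used both for multi-indices `α` and for grid points `u`). -/
abbrev Box (d N : ℕ) := Fin d → Fin N

/-- Multivariate Vandermonde matrix on the grid: `V α u = ∏ i, (u i)^(α i)`. -/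
noncomputable def vand (d N : ℕ) : Matrix (Box d N) (Box d N) ℝ :=
  fun α u => ∏ i, ((u i : ℕ) : ℝ) ^ (α i : ℕ)

open Classical in
/-- The triangular moment-transfer matrix: `T α γ = C(α,γ) · M(α − γ)` for `γ ≤ α`, else `0`. -/
noncomputable def tri (d N : ℕ) (M : (Fin d → ℕ) → ℝ) : Matrix (Box d N) (Box d N) ℝ :=
  fun α γ => if γ ≤ α then (∏ i, (((α i : ℕ).choose (γ i : ℕ) : ℕ) : ℝ)) * M (fun i => (α i : ℕ) - (γ i : ℕ)) else 0

/-- Moments of translates: `m α u = Σ_γ T α γ · V γ u`. -/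
noncomputable def momentOfTranslate (d N : ℕ) (M : (Fin d → ℕ) → ℝ) (α u : Box d N) : ℝ :=
  ∑ γ : Box d N, tri d N M α γ * vand d N γ u

/-- The moment of a translate is the `(α,u)` entry of the matrix product `tri * vand`. [folklore] -/
theorem momentOfTranslate_eq_mul (M : (Fin d → ℕ) → ℝ) (α u : Box d N) :
    momentOfTranslate d N M α u = (tri d N M * vand d N) α u := by
  simp [momentOfTranslate, Matrix.mul_apply]

/-! ## The Vandermonde factor is invertible -/

/-- The exponent of a box multi-index as a finsupp. -/
noncomputable def expo (α : Box d N) : Fin d →₀ ℕ :=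
  Finsupp.equivFunOnFinite.symm (fun i => (α i : ℕ))

/-- Coordinates of the exponent vector `expo α`. -/
@[simp] theorem expo_apply (α : Box d N) (i : Fin d) : expo α i = (α i : ℕ) := by
  simp [expo]

/-- `expo` is injective on the index box. -/
theorem expo_injective : Function.Injective (expo (d := d) (N := N)) := by
  intro α β h
  funext i
  apply Fin.ext
  have := congrArg (fun f => f i) h
  simpa using this

/-- The polynomial `Σ_α c α X^α`. -/
noncomputable def poly (c : Box d N → ℝ) : MvPolynomial (Fin d) ℝ :=
  ∑ α : Box d N, MvPolynomial.monomial (expo α) (c α)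

/-- Evaluation of the grid polynomial `poly c`: `Σ_α c α · x^α`. [folklore] -/
theorem eval_poly (c : Box d N → ℝ) (x : Fin d → ℝ) :
    MvPolynomial.eval x (poly c) = ∑ α : Box d N, c α * ∏ i, x i ^ (α i : ℕ) := by
  simp only [poly, map_sum, MvPolynomial.eval_monomial]
  refine Finset.sum_congr rfl fun α _ => ?_
  congr 1
  rw [Finsupp.prod_fintype]
  · simp
  · intro i; simp

/-- The coefficient of `x^α` in `poly c` is `c α`. -/
theorem coeff_poly (c : Box d N → ℝ) (α : Box d N) :
    MvPolynomial.coeff (expo α) (poly c) = c α := by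
  simp only [poly, MvPolynomial.coeff_sum, MvPolynomial.coeff_monomial]
  rw [Finset.sum_eq_single α]
  · simp
  · intro β _ hβ
    rw [if_neg]
    exact fun h => hβ (expo_injective h)
  · intro h; exact absurd (Finset.mem_univ α) h

/-- Every partial degree of `poly c` is `< N`. -/
theorem degreeOf_poly_lt (c : Box d N → ℝ) (i : Fin d) (hN : 0 < N) :
    (poly c).degreeOf i < N := by
  have h : (poly c).degreeOf i ≤ N - 1 := by
    rw [MvPolynomial.degreeOf_le_iff]
    intro m hm
    have hsub := MvPolynomial.support_sum (s := (Finset.univ : Finset (Box d N)))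
      (f := fun α => MvPolynomial.monomial (expo α) (c α)) hm
    simp only [Finset.mem_biUnion, Finset.mem_univ, true_and] at hsub
    obtain ⟨α, hα⟩ := hsub
    have hm' : m = expo α := by
      classical
      rw [MvPolynomial.support_monomial] at hα
      split_ifs at hα with h0
      · simp at hα
      · simpa using hα
    subst hm'
    simp only [expo_apply]
    have := (α i).isLt
    omega
  omega

/-- The multivariate Vandermonde matrix on the grid `{0,…,N−1}ᵈ` has trivial left kernel (a polynomial of partial
degrees `< N` vanishing on the grid is zero: `MvPolynomial.eq_zero_of_eval_zero_at_prod_finset`). [folklore] -/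
theorem vecMul_vand_injective : Function.Injective (fun c : Box d N → ℝ => Matrix.vecMul c (vand d N)) := by
  classical
  rcases isEmpty_or_nonempty (Box d N) with hE | hE
  · intro c c' _; exact Subsingleton.elim _ _
  -- `N > 0` as soon as there is a coordinate
  have hN : ∀ i : Fin d, 0 < N := fun i => by
    obtain ⟨α⟩ := hE; exact Fin.pos (α i)
  -- linear map ⇒ enough to show the kernel is trivial
  suffices h0 : ∀ c : Box d N → ℝ, Matrix.vecMul c (vand d N) = 0 → c = 0 by
    intro c c' h
    have : Matrix.vecMul (c - c') (vand d N) = 0 := by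
      rw [Matrix.sub_vecMul]; exact sub_eq_zero.mpr h
    exact sub_eq_zero.mp (h0 _ this)
  intro c hc
  -- the polynomial `Σ c_α X^α` vanishes on the grid
  let S : Fin d → Finset ℝ := fun _ => Finset.univ.image (fun k : Fin N => ((k : ℕ) : ℝ))
  have hS : ∀ i, #(S i) = N := by
    intro i
    rw [Finset.card_image_of_injective _ (fun a b h => Fin.ext (by exact_mod_cast h))]
    simp
  have hP : poly c = 0 := by
    refine MvPolynomial.eq_zero_of_eval_zero_at_prod_finset (poly c) S ?_ ?_
    · intro i; rw [hS i]; exact degreeOf_poly_lt c i (hN i)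
    · intro x hx
      -- `x` is a grid point
      have hx' : ∀ i, ∃ k : Fin N, x i = ((k : ℕ) : ℝ) := by
        intro i
        have := hx i
        simp only [S, Finset.mem_image, Finset.mem_univ, true_and] at this
        obtain ⟨k, hk⟩ := this
        exact ⟨k, hk.symm⟩
      choose u hu using hx'
      have hxu : x = fun i => ((u i : ℕ) : ℝ) := funext hu
      rw [eval_poly, hxu]
      have := congrArg (fun f => f u) hc
      simpa [Matrix.vecMul, dotProduct, vand] using this
  funext α
  have := coeff_poly c α
  rw [hP, MvPolynomial.coeff_zero] at this
  simpa using this.symm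

/-- The multivariate Vandermonde matrix on the grid is invertible. [folklore] -/
theorem isUnit_vand : IsUnit (vand d N) :=
  Matrix.vecMul_injective_iff_isUnit.mp vecMul_vand_injective

/-! ## The triangular factor is invertible -/

/-- Diagonal entries of the triangular factor are `M 0`. -/
theorem tri_diag (M : (Fin d → ℕ) → ℝ) (α : Box d N) : tri d N M α α = M 0 := by
  classical
  simp [tri, Pi.zero_def]

/-- The triangular factor vanishes off the lower set `γ ≤ α`. -/
theorem tri_of_not_le (M : (Fin d → ℕ) → ℝ) {α γ : Box d N} (h : ¬ γ ≤ α) : tri d N M α γ = 0 := by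
  classical
  simp [tri, h]

/-- The triangular factor has trivial right kernel when `M 0 ≠ 0` (induction along the partial order). [folklore] -/
theorem mulVec_tri_injective (M : (Fin d → ℕ) → ℝ) (hM : M 0 ≠ 0) :
    Function.Injective (fun c : Box d N → ℝ => Matrix.mulVec (tri d N M) c) := by
  classical
  suffices h0 : ∀ c : Box d N → ℝ, Matrix.mulVec (tri d N M) c = 0 → c = 0 by
    intro c c' h
    have : Matrix.mulVec (tri d N M) (c - c') = 0 := by
      rw [Matrix.mulVec_sub]; exact sub_eq_zero.mpr h
    exact sub_eq_zero.mp (h0 _ this)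
  intro c hc
  by_contra hne
  -- a minimal index in the support of `c`
  have hsupp : (Finset.univ.filter fun γ : Box d N => c γ ≠ 0).Nonempty := by
    by_contra h
    rw [Finset.not_nonempty_iff_eq_empty, Finset.filter_eq_empty_iff] at h
    exact hne (funext fun γ => by simpa using h (Finset.mem_univ γ))
  obtain ⟨γ₀, hγ₀, hmin⟩ := (Finset.univ.filter fun γ : Box d N => c γ ≠ 0).exists_minimal hsupp
  have hc₀ : c γ₀ ≠ 0 := (Finset.mem_filter.mp hγ₀).2
  -- row `γ₀` of `T c = 0` reads `M 0 · c γ₀ = 0`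
  have hrow : (Matrix.mulVec (tri d N M) c) γ₀ = M 0 * c γ₀ := by
    simp only [Matrix.mulVec, dotProduct]
    rw [Finset.sum_eq_single γ₀]
    · rw [tri_diag]
    · intro γ _ hγ
      by_cases hle : γ ≤ γ₀
      · -- `γ < γ₀` forces `c γ = 0` by minimality
        have : ¬ (c γ ≠ 0) := by
          intro hcγ
          have hge : γ₀ ≤ γ := hmin (Finset.mem_filter.mpr ⟨Finset.mem_univ _, hcγ⟩) hle
          exact hγ (le_antisymm hle hge)
        push Not at this
        simp [this]
      · rw [tri_of_not_le M hle, zero_mul]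
    · intro h; exact absurd (Finset.mem_univ _) h
  rw [hc] at hrow
  simp only [Pi.zero_apply] at hrow
  exact mul_ne_zero hM hc₀ hrow.symm

/-- The triangular factor is invertible when `M 0 ≠ 0`. [folklore] -/
theorem isUnit_tri (M : (Fin d → ℕ) → ℝ) (hM : M 0 ≠ 0) : IsUnit (tri d N M) :=
  Matrix.mulVec_injective_iff_isUnit.mp (mulVec_tri_injective M hM)


/-! ## Binomial (integral-side) form of the moments of translates -/

/-- `m α u = Σ_{κ ≤ α} (∏ i, C(α i, κ i) · (u i)^(α i − κ i)) · M κ` — the form produced by expanding `∫ b(w) (w + u)^α dw`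
binomially (`κ` = the exponent carried by `w`). [folklore] -/
theorem momentOfTranslate_eq_binomial (M : (Fin d → ℕ) → ℝ) (α u : Box d N) :
    momentOfTranslate d N M α u =
      ∑ κ ∈ Fintype.piFinset (fun i => Finset.range ((α i : ℕ) + 1)),
        (∏ i, ((((α i : ℕ).choose (κ i) : ℕ) : ℝ) * ((u i : ℕ) : ℝ) ^ ((α i : ℕ) - κ i))) * M κ := by
  classical
  -- restrict the `γ`-sum to `γ ≤ α`
  have h1 : momentOfTranslate d N M α u =
      ∑ γ ∈ Finset.univ.filter (fun γ : Box d N => γ ≤ α),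
        ((∏ i, (((α i : ℕ).choose (γ i : ℕ) : ℕ) : ℝ)) * M (fun i => (α i : ℕ) - (γ i : ℕ))) *
          ∏ i, ((u i : ℕ) : ℝ) ^ (γ i : ℕ) := by
    rw [momentOfTranslate, Finset.sum_filter]
    refine Finset.sum_congr rfl fun γ _ => ?_
    by_cases h : γ ≤ α
    · simp [tri, vand, h]
    · simp [tri, h]
  rw [h1]
  -- re-index `γ ↦ κ = α − γ`
  refine Finset.sum_nbij' (fun γ => fun k => (α k : ℕ) - (γ k : ℕ))
    (fun κ => fun k => ⟨(α k : ℕ) - κ k, lt_of_le_of_lt (Nat.sub_le _ _) (α k).isLt⟩) ?_ ?_ ?_ ?_ ?_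
  · intro γ hγ
    simp only [Fintype.mem_piFinset, Finset.mem_range]
    intro k; omega
  · intro κ hκ
    simp only [Finset.mem_filter, Finset.mem_univ, true_and]
    intro k
    rw [Fin.le_def]
    exact Nat.sub_le _ _
  · intro γ hγ
    simp only [Finset.mem_filter, Finset.mem_univ, true_and] at hγ
    funext k
    apply Fin.ext
    have hk : (γ k : ℕ) ≤ (α k : ℕ) := hγ k
    simp only
    omega
  · intro κ hκ
    simp only [Fintype.mem_piFinset, Finset.mem_range] at hκ
    funext k
    have hk := hκ k
    simp only
    omega
  · intro γ hγ
    simp only [Finset.mem_filter, Finset.mem_univ, true_and] at hγ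
    have hk : ∀ k, (γ k : ℕ) ≤ (α k : ℕ) := fun k => hγ k
    have hsub : ∀ k, (α k : ℕ) - ((α k : ℕ) - (γ k : ℕ)) = (γ k : ℕ) := fun k => Nat.sub_sub_self (hk k)
    have hch : ∀ k, (α k : ℕ).choose ((α k : ℕ) - (γ k : ℕ)) = (α k : ℕ).choose (γ k : ℕ) :=
      fun k => Nat.choose_symm (hk k)
    simp only [hsub, hch]
    rw [Finset.prod_mul_distrib]
    ring

/-! ## Solvability of the moment system -/

/-- **H1-algebra.** For every moment table `M` with `M 0 ≠ 0` and every target `t` on the box `{0,…,N−1}ᵈ` there are weights `λ_u`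
on the grid with `Σ_u λ_u · m α u = t α` for all `α`, where `m α u = Σ_{γ ≤ α} C(α,γ) M(α−γ) u^γ` is the order-`α` moment of the
translate by `u`. [folklore] -/
theorem exists_weights_of_moments (d N : ℕ) (M : (Fin d → ℕ) → ℝ) (hM : M 0 ≠ 0) (t : Box d N → ℝ) :
    ∃ lam : Box d N → ℝ, ∀ α : Box d N, ∑ u : Box d N, lam u * momentOfTranslate d N M α u = t α := by
  have hA : IsUnit (tri d N M * vand d N) := (isUnit_tri M hM).mul isUnit_vand
  obtain ⟨lam, hlam⟩ := Matrix.mulVec_surjective_iff_isUnit.mpr hA t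
  refine ⟨lam, fun α => ?_⟩
  have := congrArg (fun f => f α) hlam
  simp only [Matrix.mulVec, dotProduct] at this
  rw [← this]
  refine Finset.sum_congr rfl fun u _ => ?_
  rw [momentOfTranslate_eq_mul, mul_comm]

end Summit.QuantumFields.YangMills.Cruxes.AtomicSynthesis.SingleSlotPlan
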